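import Mathlib
import Summits.PneNP.PneNP.Theorems.SfmBlParamsFP

/-!
# Sign-degree-2 engine, MACHINE LAYER G3: the `O(log N)` parameters and their magnitudes (cell pnp-ideate,
# ROUND-18 item K1'' `SignDeg2Signing.SignDeg2SigningFP`, stage S3)

FRONTIER (range avoidance for sign-degree-≤2 local maps at linear stretch; restricted-model algorithmic
rung); nothing here bears on P vs NP.

Twin of `SfmBlParamsFP` for the parametric pipeline `Sd2Bl.legBound_of_pipeline`, whose side conditions are
`N ≤ 2^b`, `20·N ≤ 2^(2^(j+1))`, `2·2^(j+2) + 2b ≤ 10(t₀+1)` (the last one doubled w.r.t. CAND: the `ℓ`-scaling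
of Prop. 7 costs a factor `L^{2k}` in the junk term).  Canonical choice from `N` (bit sizes):

  `b = size N`,   `j + 1 = size (size (20·N))`,   `t₀ = (4·2^(j+1) + 2b) / 10`

(`pB`, `pJ1`, `pT0`; clamped copies `pT0'`, `pQ1'` for exact unary conversions, inactive for `N ≥ 1`).
Proved: the side conditions (`g_params_spec`), and the magnitudes for a degree cap `L = 4^t` with a FREE `t`
(`g_params_bounds`): with `s₀ = size (20N)`, `2^(j+1) ≤ 2s₀`, `2^(j+2) ≤ 4s₀`, `t₀ ≤ s₀`, `2^s₀ ≤ 40N`, hence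
`(4^t)^(2^(j+2)) ≤ (40N)^(8t)` (closed-walk enumeration), `(4^t)^(2t₀) ≤ (40N)^(4t)` (candidate walks),
`2^t₀ ≤ 40N` (sub-pairs of a spot) and the clamp facts.  Plus the fraction form of the hat threshold
`A₃ = (6/5)(4V·L⁻¹⁰ + 1) = 6(4V + L^10)/(5L^10)` (`g_A₃_frac`; `A₁ = 10(N·R^ℓ + 1)` is an integer since the
radius `R` is) for the one-integer-comparison form of the greedy step (`SfmBl.frac_compare_int_iff`).
-/

set_option linter.dupNamespace false -- `Summit.PneNP.PneNP.…`: summit = sub-problem name (D-0017 single-conjunct layout)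

namespace Summit.PneNP.PneNP.Theorems.Sd2BlMachine

open Summit.PneNP.PneNP.Theorems.SfmBl

/-! ## The parameter choice -/

/-- `b = size N`. -/
def pB (N : ℕ) : ℕ := Nat.size N

/-- `j + 1 = size (size (20N))`. -/
def pJ1 (N : ℕ) : ℕ := Nat.size (Nat.size (20 * N))

/-- `t₀ = (4·2^(j+1) + 2b) / 10`. -/
def pT0 (N : ℕ) : ℕ := (4 * 2 ^ pJ1 N + 2 * pB N) / 10

/-- `t₀` clamped by `40N` (inactive for `N ≥ 1`; makes the unary conversion exact on every input). -/
def pT0' (N : ℕ) : ℕ := min (pT0 N) (40 * N)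

/-- `q + 1 = 2^(j+1)` clamped by `40N` (inactive for `N ≥ 1`). -/
def pQ1' (N : ℕ) : ℕ := min (2 ^ pJ1 N) (40 * N)

/-- THE SIDE CONDITIONS of `legBound_of_pipeline` for the canonical parameters. -/
theorem g_params_spec {N : ℕ} {b j t₀ : ℕ} (hb : b = pB N) (hj : j + 1 = pJ1 N) (ht : t₀ = pT0 N) :
    N ≤ 2 ^ b ∧ 20 * N ≤ 2 ^ (2 ^ (j + 1)) ∧ 2 * 2 ^ (j + 2) + 2 * b ≤ 10 * (t₀ + 1) := by
  refine ⟨hb ▸ (Nat.lt_size_self N).le, ?_, ?_⟩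
  · calc 20 * N ≤ 2 ^ Nat.size (20 * N) := (Nat.lt_size_self _).le
      _ ≤ 2 ^ (2 ^ (j + 1)) := by
          apply Nat.pow_le_pow_right (by norm_num)
          rw [hj]; exact (Nat.lt_size_self _).le
  · rw [ht, pT0, ← hj, hb, pB, pow_succ]; omega

/-- The exponent `j + 1 = size (size (20N))` is positive. -/
theorem g_params_j_ok {N : ℕ} (hN : 1 ≤ N) : (pJ1 N - 1) + 1 = pJ1 N := by
  have h5 := five_le_size_twenty_mul hN
  have : 0 < Nat.size (Nat.size (20 * N)) := Nat.size_pos.mpr (by omega)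
  unfold pJ1; omega

/-- THE MAGNITUDE BOUNDS for the canonical parameters (degree cap `4^t`, `t` free). -/
theorem g_params_bounds {N : ℕ} (hN : 1 ≤ N) {b j t₀ : ℕ} (hb : b = pB N) (hj : j + 1 = pJ1 N)
    (ht : t₀ = pT0 N) (t : ℕ) :
    2 ^ (j + 1) ≤ 2 * Nat.size (20 * N) ∧
    2 ^ (j + 2) ≤ 4 * Nat.size (20 * N) ∧
    t₀ ≤ Nat.size (20 * N) ∧
    2 ^ Nat.size (20 * N) ≤ 40 * N ∧
    (2 ^ (2 * t)) ^ (2 ^ (j + 2)) ≤ (40 * N) ^ (8 * t) ∧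
    (2 ^ (2 * t)) ^ (2 * t₀) ≤ (40 * N) ^ (4 * t) ∧
    2 ^ t₀ ≤ 40 * N ∧
    t₀ ≤ 40 * N ∧
    2 ^ (j + 1) ≤ 40 * N := by
  set s := Nat.size (20 * N) with hs
  have h5 : 5 ≤ s := five_le_size_twenty_mul hN
  obtain ⟨h40, hss⟩ := sfmBl_two_pow_size_bounds hN
  rw [← hs] at h40 hss
  have hk : 2 ^ (j + 1) ≤ 2 * s := by rw [hj]; exact hss
  have hk2 : 2 ^ (j + 2) ≤ 4 * s := by rw [pow_succ]; omega
  have hbs : b ≤ s := by rw [hb, pB, hs]; exact Nat.size_le_size (by omega)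
  have ht1 : t₀ ≤ s := by rw [ht, pT0, ← hj, ← hb]; omega
  have h2s : 2 * s ≤ 2 ^ s := by
    have h1 : s - 1 < 2 ^ (s - 1) := Nat.lt_two_pow_self
    have h2 : 2 ^ s = 2 * 2 ^ (s - 1) := by rw [← pow_succ']; congr 1; omega
    omega
  have hs20 : s ≤ 40 * N := by omega
  refine ⟨hk, hk2, ht1, h40, ?_, ?_, ?_, ht1.trans hs20, hk.trans (h2s.trans h40)⟩
  · calc (2 ^ (2 * t)) ^ (2 ^ (j + 2)) ≤ (2 ^ (2 * t)) ^ (4 * s) := Nat.pow_le_pow_right (by positivity) hk2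
      _ = (2 ^ s) ^ (8 * t) := by rw [← pow_mul, ← pow_mul]; congr 1; ring
      _ ≤ (40 * N) ^ (8 * t) := Nat.pow_le_pow_left h40 _
  · calc (2 ^ (2 * t)) ^ (2 * t₀) ≤ (2 ^ (2 * t)) ^ (2 * s) :=
          Nat.pow_le_pow_right (by positivity) (by omega)
      _ = (2 ^ s) ^ (4 * t) := by rw [← pow_mul, ← pow_mul]; congr 1; ring
      _ ≤ (40 * N) ^ (4 * t) := Nat.pow_le_pow_left h40 _
  · exact (Nat.pow_le_pow_right (by norm_num) ht1).trans h40

/-- The clamps are inactive for `N ≥ 1`. -/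
theorem g_clamps_eq {N : ℕ} (hN : 1 ≤ N) : pT0' N = pT0 N ∧ pQ1' N = 2 ^ pJ1 N := by
  have h := g_params_bounds hN rfl (g_params_j_ok hN) rfl 0
  rw [g_params_j_ok hN] at h
  obtain ⟨_, _, _, _, _, _, _, h8, h9⟩ := h
  exact ⟨min_eq_left h8, min_eq_left h9⟩

/-! ## The hat threshold as a fraction -/

/-- `A₃ = (6/5)(4V·L⁻¹⁰ + 1) = 6(4V + L^10) / (5·L^10)` for `L > 0`. -/
theorem g_A₃_frac (V L : ℕ) (hL : 0 < L) :
    (6 : ℝ) / 5 * (4 * (V : ℝ) * (((L : ℝ)) ^ 10)⁻¹ + 1)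
      = ((6 * (4 * V + L ^ 10) : ℕ) : ℝ) / ((5 * L ^ 10 : ℕ) : ℝ) := by
  have hL' : (0 : ℝ) < (L : ℝ) ^ 10 := by positivity
  have key : ∀ D : ℝ, 0 < D → (6 : ℝ) / 5 * (4 * (V : ℝ) * D⁻¹ + 1) = 6 * (4 * V + D) / (5 * D) := by
    intro D hD; field_simp
  rw [key _ hL']
  push_cast
  ring

/-- `A₁ = 10(N·R^ℓ + 1)` as a fraction with denominator `1`. -/
theorem g_A₁_frac (N R ℓ : ℕ) :
    (10 : ℝ) * ((N : ℝ) * (R : ℝ) ^ ℓ + 1) = ((10 * (N * R ^ ℓ + 1) : ℕ) : ℝ) / ((1 : ℕ) : ℝ) := by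
  push_cast
  ring

/-- Positivity of the numerators / denominators (for `frac_compare_int_iff`). -/
theorem g_fracs_pos (N R ℓ V L : ℕ) (hL : 0 < L) :
    0 < 10 * (N * R ^ ℓ + 1) ∧ 0 < (1 : ℕ) ∧ 0 < 6 * (4 * V + L ^ 10) ∧ 0 < 5 * L ^ 10 := by
  refine ⟨by positivity, by norm_num, ?_, by positivity⟩
  have : 0 < L ^ 10 := by positivity
  omega

end Summit.PneNP.PneNP.Theorems.Sd2BlMachine
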